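import Summits.ValiantsHypothesis.ValiantsHypothesis.Theorems.EquivariantDialHeredity
import HarnessLib

/-!
# RATE HEREDITY — the small-head window down to polylog heads (lens-1 g35)

Fifth engine for the dial `W ⟺ EqHard H ∧ SymCheap H` of `EquivariantDialNode`.  The g34 heredity law
(`eqHard_of_heredity`) compares notches of different sizes but only at POLYNOMIAL size change
(`IsPBounded fun n => n + b n`), because it moves the qualitative statement `EqHard`; it therefore reaches
only polynomially co-final heads `t(m) ≥ m^{Ω(1)}` and leaves the SMALL-HEAD WINDOW `c < t(m) < m^{o(1)}`
undecided.  This file moves a QUANTITY instead: the diagonal cell is known at RATE strength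
(Dawar–Wilsenach `2^{εn}` infinitely often, through `diag_permify` + `stub_toSymmetricCircuit`, all
proved in the tree), and head restriction (`hasEquivariantDetRepr_head`) preserves the SIZE of a
representation exactly — so the admissible size change is whatever the rate absorbs: quasi-polynomial at
`NotQP` strength, sub-exponential `2^{o(n^{1/D})}` at `EqHard` strength.

## Engine (§1), law (§2), instances (§3)

* `diag_rate` (§1): there is `D` (the permify exponent `+ 1`) such that every family of
  `Δ𝔖_n`-equivariant affine determinantal representations of `per_n` of sizes `≤ 2^{L n}` has
  `n ≤ a (L n + a)^D` infinitely often — log-size `Ω(n^{1/D})` i.o.; the tree's `diag_notQP` is its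
  quasi-polynomial shadow.  Unconditional, NOT implied by `S` (restricted-model lower bound).
* `rate_of_heredity` (§2): for ANY notch family `K` whose member at size `n + b n` contains the
  tail-identity extension of `Δ𝔖_n` (`Δ𝔖_n ⊕ 1 ≤ K (n + b n)`), a `K`-equivariant
  family of sizes `≤ 2^{L m}` forces `n ≤ a (L (n + b n) + a)^D` i.o.  Consequences:
  `eqHard_of_rateHeredity` (`EqHard K` as soon as `log₂ (n + b n) = o(n^{1/D})`, stated
  `∀ a, eventually a (log₂(n + b n) + a)^D < n`) and, from
  `diag_notQP` directly, `notQP_of_qpHeredity` / `eqHard_of_qpHeredity` (QUASI-POLYNOMIAL reach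
  `n + b n ≤ 2^{(log₂ n + k)^k}` preserves `NotQP`).
* §3, diagonal heads `Δ(𝔖_{t(m)} ⊕ 1)` (`diagHeadSubst t`): `notQP_diagHead` / `eqHard_diagHead_qp`
  for every quasi-polynomially co-final `t`; ★ `notQP_diagHead_window` / `eqHard_diagHead_window`
  for `t(m) = 2^{⌊√(log₂ m)⌋} = m^{1/√(log₂ m)}` — a head INSIDE the window `c < t < m^{o(1)}`, of
  superpolynomial order `t!`, unreachable by the index law (g33) and by p-bounded heredity (g34);
  ★★ `eqHard_diagHead_polylog`: `∃ D, ∀ E > D, EqHard Δ(𝔖_{(log₂ m)^E} ⊕ 1)` — POLYLOG HEADS ARE HARD.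

## Dial map after g35 (census row W33/D6 «small-head window»)

HARD: every diagonal head with `t(m) ≥ (log₂ m)^E`, `E > D` (on its reach), in particular all
`t(m) = 2^{(log₂ m)^δ}` and `m^{o(1)}` heads; by `EqHard.mono` every notch containing such a head.
COSTUME (`⟺ W`, index law g33 `eqHard_iff_W_of_card`): heads of p-bounded order `t(m)!`, i.e.
`t ≲ log₂ m / log₂ log₂ m`.  OPEN: only the POLYLOG SLIVER `log m / log log m ≲ t(m) ≲ (log₂ m)^D`.

## HONEST BOUNDARY (K5)

HONEST BOUNDARY: 0 S-currency; closes NO item; `EqHard` conclusions are S-implied (S ⇒ W ⇒ EqHard H),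
the `NotQP`/rate conclusions are restricted-model lower bounds of Dawar–Wilsenach class (symmetric =
equivariant model), not statements about dc(per_m); the exponent `D` is the loss of `diag_permify`
(`2^{(log s + d)^d}`) and is NOT computed here — the true threshold of the window is plausibly
`t ≍ log m` and the sliver `(log m / log log m, (log m)^D)` stays UNDECIDED · IDEA-NEEDED (it closes iff
permify is improved to polynomial loss, cf. item stmt-10343, or the index law is beaten); P-ROW and the
cyclic notches `Δ⟨π⟩` of superpolynomial order are NOT touched; stmt-23702 / VP ≠ VNP untouched.

* DELTA vs tree: `notQP_of_permify` / `diag_notQP` fix the conclusion at quasi-polynomial strength and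
  one matrix size; `eqHard_of_heredity` (g34) needs `IsPBounded (n + b n)`.  A rate statement for an
  equivariant cell and size-change beyond polynomial are new in the tree.
* DELTA vs literature: [DawarWilsenach2025, Thm. 7.1] is the `2^{εn}` bound for SYMMETRIC CIRCUITS under
  the full `𝔖_n`; [Engels2020, Lemma 3.9 / Thm. 3.10] already observes, in the CIRCUIT model, that
  symmetry under a corner group `𝔖_k × 𝔖_k ⊕ 1` forces size `≥ k (2^{k-1} - 1)` (superpolynomial once
  `k ≫ log n`, Jerrum–Snir parse graphs); [LandsbergRessayre2017, Question 2.2] / Landsberg 2017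
  §7.4.1, p. 194 («I do not know just how large the symmetry group needs to be») ask it for
  EQUIVARIANT DETERMINANTAL complexity.  Here: the LR model (exact `GL × GL` lifts), where the passage
  to circuits costs quasi-polynomially (`diag_permify`) — whence the polylog, not log, threshold — and
  DIAGONAL heads; unrecorded in our corpus + galaxy searches (NOTES: presearch).
* Reused BY NAME (no re-proofs): `diag_permify`, `SymPencilEquivariantSdcNotQP.stub_toSymmetricCircuit`,
  `squareSymmetricPermLB_holds` (DW Thm 7.1, proved), `polylog_eventually_lt`, `diag_notQP`,
  `qpBound_comp_qpBound`, `IsPBounded.isQPBounded`, `hasEquivariantDetRepr_head`, `headExt`,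
  `headExt_mem_headPerms`, `headPerms`, `diagHeadSubst`, `diagHom`, `biPermHom`, `diagPermSubst_eq_map`.
-/

set_option linter.dupNamespace false

noncomputable section

namespace Summit.ValiantsHypothesis.ValiantsHypothesis.Theorems.EquivariantDialRateHeredity

open MvPolynomial Matrix Literature.Computability.AlgebraicComplexity
open Summit.ValiantsHypothesis.ValiantsHypothesis.Theses
open Summit.ValiantsHypothesis.ValiantsHypothesis.Theorems.EquivariantDialNode
open Summit.ValiantsHypothesis.ValiantsHypothesis.Theorems.EquivariantDialPolyIndex
open Summit.ValiantsHypothesis.ValiantsHypothesis.Theorems.EquivariantDialDiagonalPermify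
  (diagPermSubst diag_permify)
open Summit.ValiantsHypothesis.ValiantsHypothesis.Theorems.EquivariantDialDiagonalNotQP (diag_notQP)
open Summit.ValiantsHypothesis.ValiantsHypothesis.Theorems.SymPencilSdcThesisSplit (qpBound_comp_qpBound)
open Summit.ValiantsHypothesis.ValiantsHypothesis.Theorems.SymPencilEquivariantSdcNotQP.Closer

/-! ### §1 The diagonal cell at RATE strength -/

/-- Arithmetic: `(2^k + 2)^e ≤ 2^{e (k + 2)}`. [folklore] -/
theorem two_pow_add_two_pow_le (k e : ℕ) : (2 ^ k + 2) ^ e ≤ 2 ^ (e * (k + 2)) := by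
  have hk : 1 ≤ 2 ^ k := Nat.one_le_two_pow
  have h : 2 ^ k + 2 ≤ 2 ^ (k + 2) := by
    calc 2 ^ k + 2 ≤ 2 ^ k * 4 := by omega
      _ = 2 ^ (k + 2) := by rw [pow_add]; norm_num
  calc (2 ^ k + 2) ^ e ≤ (2 ^ (k + 2)) ^ e := Nat.pow_le_pow_left h e
    _ = 2 ^ (e * (k + 2)) := by rw [← pow_mul, mul_comm]

/-- Arithmetic: `(L + d)^d + 2 ≤ (L + a)^{d+1}` once `d + 3 ≤ a`. [folklore] -/
theorem pow_add_two_le_pow_succ {L d a : ℕ} (ha : d + 3 ≤ a) :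
    (L + d) ^ d + 2 ≤ (L + a) ^ (d + 1) := by
  have h1 : (L + d) ^ d ≤ (L + a) ^ d := Nat.pow_le_pow_left (by omega) d
  have h2 : 1 ≤ (L + a) ^ d := Nat.one_le_pow _ _ (by omega)
  calc (L + d) ^ d + 2 ≤ (L + a) ^ d + 2 * (L + a) ^ d := by omega
    _ = 3 * (L + a) ^ d := by ring
    _ ≤ (L + a) * (L + a) ^ d := Nat.mul_le_mul_right _ (by omega)
    _ = (L + a) ^ (d + 1) := by ring

/-- ★ **THE DIAGONAL CELL AT RATE STRENGTH.**  There is `D` such that every family of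
`Δ𝔖_n`-equivariant (exact `GL × GL` lifts) affine determinantal representations of the permanents of
sizes `≤ 2^{L n}` satisfies `n ≤ a (L n + a)^D` for some `a` and infinitely many `n` — log-size
`Ω(n^{1/D})` infinitely often.  Chain: `diag_permify` (size `2^{(log s + d)^d}`, permutation lifts),
`stub_toSymmetricCircuit` (symmetric circuits of size `(s'+2)^e`), Dawar–Wilsenach Thm. 7.1
(`squareSymmetricPermLB_holds`: `2^{εn} ≤` size i.o.); `D = d + 1`.  Restricted-model lower bound;
0 S-currency; closes NO item. [cite: DawarWilsenach2025, Thm. 7.1] [cite: LandsbergRessayre2017, Def. 1.3] -/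
theorem diag_rate : ∃ D : ℕ, ∀ L : ℕ → ℕ,
    (∀ n, ∃ s ≤ 2 ^ L n, HasEquivariantDetRepr (diagPermSubst n) (perPoly (Fin n) ℂ) s) →
    ∃ a : ℕ, ∀ n₀ : ℕ, ∃ n ≥ n₀, n ≤ a * (L n + a) ^ D := by
  obtain ⟨d, hd⟩ := diag_permify
  obtain ⟨e, he⟩ := SymPencilEquivariantSdcNotQP.stub_toSymmetricCircuit
  have h₃ : ProofCarryingSymmetry.SquareSymmetricPermLB := squareSymmetricPermLB_holds
  refine ⟨d + 1, fun L hL => ?_⟩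
  -- Step 1: symmetric circuits of size `2^{e ((L n + d)^d + 2)}` for every `n`
  have key : ∀ n : ℕ, ∃ (G : Type) (_ : Fintype G)
      (C : LabelledArithCircuit ℂ (Fin n × Fin n) Unit G),
      C.IsSymmetric (Equiv.Perm (Fin n)) ∧ C.eval (C.output ()) = perPoly (Fin n) ℂ ∧
        Fintype.card G ≤ 2 ^ (e * ((L n + d) ^ d + 2)) := by
    intro n
    obtain ⟨s, hs, A, hA⟩ := hL n
    obtain ⟨s', hs', A', hA', hperm⟩ := hd n s A hA
    obtain ⟨G, hG, C, hCs, hCe, hcard⟩ := he n s' A' hA' hperm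
    refine ⟨G, hG, C, hCs, hCe, hcard.trans ?_⟩
    have hlog : Nat.log 2 s ≤ L n :=
      (Nat.log_mono_right hs).trans_eq (Nat.log_pow Nat.one_lt_two _)
    have hs'' : s' ≤ 2 ^ ((L n + d) ^ d) :=
      hs'.trans (Nat.pow_le_pow_right Nat.two_pos (Nat.pow_le_pow_left (by omega) d))
    calc (s' + 2) ^ e ≤ (2 ^ ((L n + d) ^ d) + 2) ^ e := Nat.pow_le_pow_left (by omega) e
      _ ≤ 2 ^ (e * ((L n + d) ^ d + 2)) := two_pow_add_two_pow_le _ e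
  choose G hG C hCs hCe hcard using key
  obtain ⟨ε, hε, hio⟩ := @h₃ G hG C hCs hCe
  -- Step 2: along Dawar–Wilsenach's infinite set, `ε n ≤ e ((L n + d)^d + 2)`
  refine ⟨⌈(e : ℝ) / ε⌉₊ + d + 3, fun n₀ => ?_⟩
  obtain ⟨n, hn, hbig⟩ := hio n₀
  refine ⟨n, hn, ?_⟩
  have hsizeR : (Fintype.card (G n) : ℝ) ≤
      (2 : ℝ) ^ (((e * ((L n + d) ^ d + 2) : ℕ)) : ℝ) := by
    rw [Real.rpow_natCast]
    exact_mod_cast hcard n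
  have hchain := (Real.rpow_le_rpow_left_iff one_lt_two).1 (hbig.trans hsizeR)
  have hnR : (n : ℝ) ≤ (⌈(e : ℝ) / ε⌉₊ : ℝ) * (((L n + d) ^ d + 2 : ℕ) : ℝ) := by
    have h1 : (n : ℝ) ≤ ((e * ((L n + d) ^ d + 2) : ℕ) : ℝ) / ε := by
      rw [le_div_iff₀ hε]
      linarith
    have h2 : ((e * ((L n + d) ^ d + 2) : ℕ) : ℝ) / ε =
        (e : ℝ) / ε * (((L n + d) ^ d + 2 : ℕ) : ℝ) := by
      push_cast
      ring
    rw [h2] at h1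
    exact h1.trans (mul_le_mul_of_nonneg_right (Nat.le_ceil _) (by positivity))
  have hnN : n ≤ ⌈(e : ℝ) / ε⌉₊ * ((L n + d) ^ d + 2) := by exact_mod_cast hnR
  exact hnN.trans (Nat.mul_le_mul (by omega) (pow_add_two_le_pow_succ (by omega)))

/-! ### §2 RATE HEREDITY: the law -/

/-! A notch family `K : ∀ m, Subgroup (𝔖_m × 𝔖_m)` has DIAGONAL REACH `b : ℕ → ℕ` when its member
at size `n + b n` contains the tail-extended diagonal `Δ𝔖_n ⊕ 1_{b n}` (pairs `(σ ⊕ 1, σ ⊕ 1)`):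
`((⊤ : Subgroup (Equiv.Perm (Fin n))).map (diagHom n)).map ((headExt n (b n)).prodMap (headExt n (b n)))
≤ K (n + b n)`; then `per_{n + b n} ↦ per_n` restricts `K`-equivariant representations to
`Δ𝔖_n`-equivariant ones of the SAME size (`hasEquivariantDetRepr_head`). -/

variable {K : ∀ m : ℕ, Subgroup (Equiv.Perm (Fin m) × Equiv.Perm (Fin m))}

/-- ★ **RATE HEREDITY (the law).**  Head restriction preserves sizes, so the diagonal rate is
inherited along ANY reach: a `K`-equivariant family of sizes `≤ 2^{L m}` forces
`n ≤ a (L (n + b n) + a)^D` infinitely often. [folklore; cf. LandsbergRessayre2017, Question 2.2] -/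
theorem rate_of_heredity : ∃ D : ℕ,
    ∀ (K : ∀ m : ℕ, Subgroup (Equiv.Perm (Fin m) × Equiv.Perm (Fin m))) (b L : ℕ → ℕ),
    (∀ n, ((⊤ : Subgroup (Equiv.Perm (Fin n))).map (diagHom n)).map
      ((headExt n (b n)).prodMap (headExt n (b n))) ≤ K (n + b n)) →
    (∀ m, ∃ s ≤ 2 ^ L m, HasEquivariantDetRepr ((K m).map (biPermHom m)) (perPoly (Fin m) ℂ) s) →
    ∃ a : ℕ, ∀ n₀ : ℕ, ∃ n ≥ n₀, n ≤ a * (L (n + b n) + a) ^ D := by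
  obtain ⟨D, hD⟩ := diag_rate
  refine ⟨D, fun K b L hK hL => hD (fun n => L (n + b n)) fun n => ?_⟩
  obtain ⟨s, hs, hA⟩ := hL (n + b n)
  refine ⟨s, hs, ?_⟩
  rw [diagPermSubst_eq_map]
  exact hasEquivariantDetRepr_head n (b n) _ (Subgroup.map_mono (hK n)) hA

/-- Arithmetic: `m^c + c ≤ 2^{c (log₂ m + 1) + c + 1}`. [folklore] -/
theorem pow_add_le_two_pow_log (m c : ℕ) :
    m ^ c + c ≤ 2 ^ (c * (Nat.log 2 m + 1) + c + 1) := by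
  have hm : m ^ c ≤ 2 ^ (c * (Nat.log 2 m + 1)) :=
    calc m ^ c ≤ (2 ^ (Nat.log 2 m + 1)) ^ c :=
          Nat.pow_le_pow_left (Nat.lt_pow_succ_log_self Nat.one_lt_two m).le c
      _ = 2 ^ (c * (Nat.log 2 m + 1)) := by rw [← pow_mul, Nat.mul_comm]
  have hc : c ≤ 2 ^ c := (Nat.lt_pow_self Nat.one_lt_two).le
  have h1 : 1 ≤ 2 ^ (c * (Nat.log 2 m + 1)) := Nat.one_le_two_pow
  have h2 : 1 ≤ 2 ^ c := Nat.one_le_two_pow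
  calc m ^ c + c ≤ 2 ^ (c * (Nat.log 2 m + 1)) + 2 ^ c := Nat.add_le_add hm hc
    _ ≤ 2 ^ (c * (Nat.log 2 m + 1)) * 2 ^ c + 2 ^ (c * (Nat.log 2 m + 1)) * 2 ^ c :=
        Nat.add_le_add (Nat.le_mul_of_pos_right _ (by omega)) (Nat.le_mul_of_pos_left _ (by omega))
    _ = 2 ^ (c * (Nat.log 2 m + 1) + c + 1) := by ring

/-- ★★ **`EqHard` FROM RATE HEREDITY.**  If the reach is sub-exponential in the sense
`log₂ (n + b n) = o(n^{1/D})` — stated as `∀ a, eventually a (log₂ (n + b n) + a)^D < n` — then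
`per_m` has no polynomial `K`-equivariant family. [folklore; cf. LandsbergRessayre2017, Question 2.2] -/
theorem eqHard_of_rateHeredity : ∃ D : ℕ,
    ∀ (K : ∀ m : ℕ, Subgroup (Equiv.Perm (Fin m) × Equiv.Perm (Fin m))) (b : ℕ → ℕ),
    (∀ n, ((⊤ : Subgroup (Equiv.Perm (Fin n))).map (diagHom n)).map
      ((headExt n (b n)).prodMap (headExt n (b n))) ≤ K (n + b n)) →
    (∀ a : ℕ, ∃ n₀ : ℕ, ∀ n ≥ n₀, a * (Nat.log 2 (n + b n) + a) ^ D < n) →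
    EqHard fun m => (K m).map (biPermHom m) := by
  obtain ⟨D, hD⟩ := rate_of_heredity
  refine ⟨D, fun K b hK ho hP => ?_⟩
  obtain ⟨c, hc⟩ := hP
  obtain ⟨a, ha⟩ := hD K b (fun m => c * (Nat.log 2 m + 1) + c + 1) hK fun m => by
    obtain ⟨s, hs, hA⟩ := hc m
    exact ⟨s, hs.trans (pow_add_le_two_pow_log m c), hA⟩
  obtain ⟨n₀, hn₀⟩ := ho (a * (2 * c + a + 2) ^ D + 1)
  obtain ⟨n, hn, hle⟩ := ha n₀
  have hlt := hn₀ n hn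
  set M := Nat.log 2 (n + b n) with hM
  set a' := a * (2 * c + a + 2) ^ D + 1 with ha'
  have hle' : n ≤ a * (c * (M + 1) + c + 1 + a) ^ D := hle
  have h1 : c * (M + 1) + c + 1 + a ≤ (2 * c + a + 2) * (M + 1) := by
    nlinarith [Nat.zero_le (c * M), Nat.zero_le (a * M), Nat.zero_le M]
  have h2 : (c * (M + 1) + c + 1 + a) ^ D ≤ (2 * c + a + 2) ^ D * (M + 1) ^ D := by
    rw [← mul_pow]
    exact Nat.pow_le_pow_left h1 D
  have h3 : (M + 1) ^ D ≤ (M + a') ^ D := Nat.pow_le_pow_left (by omega) D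
  have hmid : a * (c * (M + 1) + c + 1 + a) ^ D ≤ a' * (M + a') ^ D :=
    calc a * (c * (M + 1) + c + 1 + a) ^ D ≤ a * ((2 * c + a + 2) ^ D * (M + 1) ^ D) :=
          Nat.mul_le_mul_left _ h2
      _ = (a * (2 * c + a + 2) ^ D) * (M + 1) ^ D := by ring
      _ ≤ a' * (M + a') ^ D := Nat.mul_le_mul (by omega) h3
  exact absurd (hle'.trans_lt (hmid.trans_lt hlt)) (lt_irrefl n)

/-- ★ **QUASI-POLYNOMIAL HEREDITY preserves `NotQP`.**  If the reach is quasi-polynomial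
(`n + b n ≤ 2^{(log₂ n + k)^k}`), there is no quasi-polynomial `K`-equivariant family — directly from
`diag_notQP` and `qp ∘ qp = qp`. [folklore; cf. LandsbergRessayre2017, Question 2.2] -/
theorem notQP_of_qpHeredity (b : ℕ → ℕ)
    (hK : ∀ n, ((⊤ : Subgroup (Equiv.Perm (Fin n))).map (diagHom n)).map
      ((headExt n (b n)).prodMap (headExt n (b n))) ≤ K (n + b n))
    (hb : ∃ k : ℕ, ∀ n, n + b n ≤ 2 ^ ((Nat.log 2 n + k) ^ k)) :
    ¬ ∃ c : ℕ, ∀ m : ℕ, ∃ s ≤ 2 ^ ((Nat.log 2 m + c) ^ c),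
      HasEquivariantDetRepr ((K m).map (biPermHom m)) (perPoly (Fin m) ℂ) s := by
  rintro ⟨c, hc⟩
  obtain ⟨k, hk⟩ := hb
  refine diag_notQP ⟨(k + 1) * (c + 1), fun n => ?_⟩
  obtain ⟨s, hs, hA⟩ := hc (n + b n)
  refine ⟨s, hs.trans (qpBound_comp_qpBound (hk n)), ?_⟩
  rw [diagPermSubst_eq_map]
  exact hasEquivariantDetRepr_head n (b n) _ (Subgroup.map_mono (hK n)) hA

/-- `EqHard K` for every notch family of quasi-polynomial diagonal reach. [folklore] -/
theorem eqHard_of_qpHeredity (b : ℕ → ℕ)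
    (hK : ∀ n, ((⊤ : Subgroup (Equiv.Perm (Fin n))).map (diagHom n)).map
      ((headExt n (b n)).prodMap (headExt n (b n))) ≤ K (n + b n))
    (hb : ∃ k : ℕ, ∀ n, n + b n ≤ 2 ^ ((Nat.log 2 n + k) ^ k)) :
    EqHard fun m => (K m).map (biPermHom m) := by
  rintro ⟨c, hc⟩
  choose s hs hA using hc
  obtain ⟨c', hc'⟩ := IsPBounded.isQPBounded (t := s) ⟨c, hs⟩
  exact notQP_of_qpHeredity b hK hb ⟨c', fun m => ⟨s m, hc' m, hA m⟩⟩

/-! ### §3 Instances: diagonal heads in and below the window -/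

/-- Diagonal heads `Δ(𝔖_{t(m)} ⊕ 1)` have diagonal reach `b` whenever `n ≤ t (n + b n)`. [folklore] -/
theorem diagReach_head {t : ℕ → ℕ} (b : ℕ → ℕ) (ht : ∀ n, n ≤ t (n + b n)) :
    ∀ n, ((⊤ : Subgroup (Equiv.Perm (Fin n))).map (diagHom n)).map
      ((headExt n (b n)).prodMap (headExt n (b n))) ≤
        (headPerms (n + b n) (t (n + b n))).map (diagHom (n + b n)) := by
  rintro n _ ⟨_, ⟨σ, -, rfl⟩, rfl⟩
  exact ⟨headExt n (b n) σ, headExt_mem_headPerms n (b n) (ht n) σ, rfl⟩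

/-- ★ QUASI-POLYNOMIALLY CO-FINAL DIAGONAL HEADS are `NotQP` (unconditional, not S-implied).
[cite: DawarWilsenach2025, Thm. 7.1] -/
theorem notQP_diagHead {t : ℕ → ℕ} (b : ℕ → ℕ)
    (hb : ∃ k : ℕ, ∀ n, n + b n ≤ 2 ^ ((Nat.log 2 n + k) ^ k)) (ht : ∀ n, n ≤ t (n + b n)) :
    ¬ ∃ c : ℕ, ∀ m : ℕ, ∃ s ≤ 2 ^ ((Nat.log 2 m + c) ^ c),
      HasEquivariantDetRepr (diagHeadSubst t m) (perPoly (Fin m) ℂ) s :=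
  notQP_of_qpHeredity (K := fun m => (headPerms m (t m)).map (diagHom m)) b (diagReach_head b ht) hb

/-- … and in particular `EqHard`. [cite: LandsbergRessayre2017, Question 2.2] -/
theorem eqHard_diagHead_qp {t : ℕ → ℕ} (b : ℕ → ℕ)
    (hb : ∃ k : ℕ, ∀ n, n + b n ≤ 2 ^ ((Nat.log 2 n + k) ^ k)) (ht : ∀ n, n ≤ t (n + b n)) :
    EqHard (diagHeadSubst t) :=
  eqHard_of_qpHeredity (K := fun m => (headPerms m (t m)).map (diagHom m)) b (diagReach_head b ht) hb

/-- The reach of the window head `t(m) = 2^{⌊√(log₂ m)⌋}`: `b n = 2^{(log₂ n + 1)^2} - n`. [folklore] -/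
theorem window_reach :
    (∃ k : ℕ, ∀ n, n + (2 ^ (Nat.log 2 n + 1) ^ 2 - n) ≤ 2 ^ ((Nat.log 2 n + k) ^ k)) ∧
    ∀ n, n ≤ 2 ^ Nat.sqrt (Nat.log 2 (n + (2 ^ (Nat.log 2 n + 1) ^ 2 - n))) := by
  have hle : ∀ n, n ≤ 2 ^ (Nat.log 2 n + 1) ^ 2 := fun n =>
    (Nat.lt_pow_succ_log_self Nat.one_lt_two n).le.trans
      (Nat.pow_le_pow_right Nat.two_pos (by nlinarith))
  refine ⟨⟨2, fun n => ?_⟩, fun n => ?_⟩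
  · rw [Nat.add_sub_cancel' (hle n)]
    exact Nat.pow_le_pow_right Nat.two_pos (Nat.pow_le_pow_left (by omega) 2)
  · rw [Nat.add_sub_cancel' (hle n), Nat.log_pow Nat.one_lt_two, Nat.sqrt_eq']
    exact (Nat.lt_pow_succ_log_self Nat.one_lt_two n).le

/-- ★ **A HEAD INSIDE THE WINDOW `c < t(m) < m^{o(1)}` DECIDED**: `t(m) = 2^{⌊√(log₂ m)⌋} = m^{o(1)}`,
a head group of superpolynomial order `t(m)!` (beyond the index law) at quasi-polynomial, not
polynomial, reach (beyond g34): `NotQP`. [cite: DawarWilsenach2025, Thm. 7.1] -/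
theorem notQP_diagHead_window : ¬ ∃ c : ℕ, ∀ m : ℕ, ∃ s ≤ 2 ^ ((Nat.log 2 m + c) ^ c),
    HasEquivariantDetRepr (diagHeadSubst (fun m => 2 ^ Nat.sqrt (Nat.log 2 m)) m)
      (perPoly (Fin m) ℂ) s :=
  notQP_diagHead (fun n => 2 ^ (Nat.log 2 n + 1) ^ 2 - n) window_reach.1 window_reach.2

/-- … and `EqHard Δ(𝔖_{2^{⌊√(log₂ m)⌋}} ⊕ 1)`. [cite: LandsbergRessayre2017, Question 2.2] -/
theorem eqHard_diagHead_window : EqHard (diagHeadSubst fun m => 2 ^ Nat.sqrt (Nat.log 2 m)) :=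
  eqHard_diagHead_qp (fun n => 2 ^ (Nat.log 2 n + 1) ^ 2 - n) window_reach.1 window_reach.2

/-- ★★ **POLYLOG HEADS ARE HARD.**  There is `D` such that for every `E > D` the permanents have no
polynomial family of `Δ(𝔖_{(log₂ m)^E} ⊕ 1)`-equivariant affine determinantal representations.
Reach `m(n) = 2^{ρ(n)}`, `ρ(n)` least with `n ≤ ρ^E ∧ n ≤ 2^ρ`; then `log₂ m(n) = ρ(n)` and
`a (ρ + a)^D < n` eventually, by minimality of `ρ` in either regime (`(ρ-1)^E < n` or `2^{ρ-1} < n`).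
[cite: DawarWilsenach2025, Thm. 7.1] [cite: LandsbergRessayre2017, Question 2.2] -/
theorem eqHard_diagHead_polylog : ∃ D : ℕ, ∀ E : ℕ, D < E →
    EqHard (diagHeadSubst fun m => Nat.log 2 m ^ E) := by
  obtain ⟨D, hD⟩ := eqHard_of_rateHeredity
  refine ⟨D, fun E hE => ?_⟩
  have hex : ∀ n : ℕ, ∃ r : ℕ, n ≤ r ^ E ∧ n ≤ 2 ^ r := fun n =>
    ⟨n, Nat.le_self_pow (by omega) n, Nat.lt_two_pow_self.le⟩
  classical
  let ρ : ℕ → ℕ := fun n => Nat.find (hex n)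
  have hρ : ∀ n, n ≤ ρ n ^ E ∧ n ≤ 2 ^ ρ n := fun n => Nat.find_spec (hex n)
  have hρmin : ∀ n r, r < ρ n → ¬ (n ≤ r ^ E ∧ n ≤ 2 ^ r) := fun n r hr => Nat.find_min (hex n) hr
  have hm : ∀ n, n + (2 ^ ρ n - n) = 2 ^ ρ n := fun n => Nat.add_sub_cancel' (hρ n).2
  refine hD (fun m => (headPerms m (Nat.log 2 m ^ E)).map (diagHom m)) (fun n => 2 ^ ρ n - n)
    (diagReach_head (t := fun m => Nat.log 2 m ^ E) _ fun n => ?_) fun a => ?_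
  · show n ≤ Nat.log 2 (n + (2 ^ ρ n - n)) ^ E
    rw [hm n, Nat.log_pow Nat.one_lt_two]
    exact (hρ n).1
  · obtain ⟨N, hN⟩ := polylog_eventually_lt D (a + 1) (show (0 : ℝ) < 1 / (a + 1) by positivity)
    refine ⟨max N ((a * 2 ^ D + a + 3) ^ E + 1), fun n hn => ?_⟩
    show a * (Nat.log 2 (n + (2 ^ ρ n - n)) + a) ^ D < n
    rw [hm n, Nat.log_pow Nat.one_lt_two]
    have hnN : N ≤ n := le_of_max_le_left hn
    have hnR : (a * 2 ^ D + a + 3) ^ E + 1 ≤ n := le_of_max_le_right hn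
    -- `ρ n` is large
    have hR : a * 2 ^ D + a + 3 ≤ ρ n := by
      by_contra h
      have h' : ρ n ^ E ≤ (a * 2 ^ D + a + 3) ^ E := Nat.pow_le_pow_left (by omega) E
      have h'' := (hρ n).1
      omega
    have hmin := hρmin n (ρ n - 1) (by omega)
    rw [not_and_or, not_le, not_le] at hmin
    rcases hmin with h1 | h2
    · -- regime `(ρ - 1)^E < n`
      have h2D : 1 ≤ 2 ^ D := Nat.one_le_two_pow
      calc a * (ρ n + a) ^ D ≤ a * (2 * (ρ n - 1)) ^ D :=
            Nat.mul_le_mul_left _ (Nat.pow_le_pow_left (by omega) D)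
        _ = a * 2 ^ D * (ρ n - 1) ^ D := by rw [mul_pow]; ring
        _ ≤ (ρ n - 1) * (ρ n - 1) ^ D := Nat.mul_le_mul_right _ (by omega)
        _ = (ρ n - 1) ^ (D + 1) := by ring
        _ ≤ (ρ n - 1) ^ E := Nat.pow_le_pow_right (by omega) hE
        _ < n := h1
    · -- regime `2^{ρ - 1} < n`: `ρ ≤ log₂ n + 1`, polylog
      have hρle : ρ n ≤ Nat.log 2 n + 1 := by
        have h := Nat.le_log_of_pow_le Nat.one_lt_two h2.le
        omega
      have h := hN n hnN
      have hR' : ((a * (ρ n + a) ^ D : ℕ) : ℝ) < n := by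
        have hcast : ((ρ n + a : ℕ) : ℝ) ≤ (Nat.log 2 n : ℝ) + ((a + 1 : ℕ) : ℝ) := by
          exact_mod_cast (show ρ n + a ≤ Nat.log 2 n + (a + 1) by omega)
        have hpow : (((ρ n + a) ^ D : ℕ) : ℝ) ≤ ((Nat.log 2 n : ℝ) + ((a + 1 : ℕ) : ℝ)) ^ D := by
          rw [Nat.cast_pow]
          exact pow_le_pow_left₀ (by positivity) hcast D
        have ha1 : (0 : ℝ) < a + 1 := by positivity
        calc ((a * (ρ n + a) ^ D : ℕ) : ℝ) = (a : ℝ) * (((ρ n + a) ^ D : ℕ) : ℝ) := by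
              push_cast; ring
          _ ≤ ((a : ℝ) + 1) * ((Nat.log 2 n : ℝ) + ((a + 1 : ℕ) : ℝ)) ^ D :=
              mul_le_mul (by linarith) hpow (by positivity) (by positivity)
          _ < ((a : ℝ) + 1) * (1 / (a + 1) * n) := mul_lt_mul_of_pos_left h ha1
          _ = n := by field_simp
      exact_mod_cast hR'

end Summit.ValiantsHypothesis.ValiantsHypothesis.Theorems.EquivariantDialRateHeredity

end
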